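import Literature.MathematicalPhysics.QuantumFieldTheory.Chatterjee2019LargeN.MasterLoopEquation
import HarnessLib

/-!
# Chatterjee 2019, Lemma 14.1: a vanishing trajectory from a loop `l` has at least `area(l)` deformations

S. Chatterjee, *Rigorous solution of strongly coupled `SO(N)` lattice gauge theory in the large `N` limit*,
Comm. Math. Phys. **366** (2019) 203–268 (arXiv:1502.07719), **§14, Lemma 14.1** («For any non-null loop `l`,
`area(l) ≤` the minimum number of deformations in a vanishing trajectory starting from `l`») and its use in the
proof of Corollary 3.3: `a_k(l) = 0` for `k < area(l)`.  Theorems over the sibling modules `LatticeStrings`,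
`StrongCoupling`, `MasterLoopEquation`, plus ONE auxiliary definition (`LoopSeq.seqChain`, the source's `r(s)`);
no named fact (net debt 0).

The printed proof is followed verbatim: the 1-chain `r` (tree `wordChain`, `edgeChain`) is extended additively to
loop sequences (`seqChain`); backtrack erasure does not change `r` (`wordChain_core`); a splitting does not change
`r(s)` (`seqChain_posSplitAt`, `seqChain_negSplitAt`); a deformation by the plaquette `p` changes it by `± r(p) = ± δp`
(`seqChain_posDeformAt`, `seqChain_negDeformAt`); hence along a vanishing trajectory with `k` deformations
`r(s₀) = Σ σ_j δ p_j = δ(Σ σ_j p_j)`, a lattice surface of area `≤ k` (`Move.exists_surface`,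
`Trajectory.exists_surface`), so
`area(l) ≤ δ(X)` for `X ∈ 𝒳((l))` (`area_le_numDeform`) and `𝒳ₖ((l)) = ∅`, `a_k(l) = 0` for `k < area(l)`
(`coeffA_singleton_eq_zero_of_lt_area`).

v1.1 (appended): `area(p) = 1` for a plaquette and «`a₀ = 0`» of §4 (`area_plaquetteWord`, `coeffA_plaquette_zero`);
Corollary 3.3 in the LOOPWISE form that the printed §14 argument actually yields from Corollary 3.5
(`areaLawUpperBound_loopwise`: `lim |⟨W_l⟩|/N ≤ M(l) (|β|/β₀)^{area(l)}`; the uniform constant `C(d)` of the printed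
statement — the named fact `AreaLawUpperBound` — is not supplied by that argument, see the section docstring).

## WHAT THIS IS NOT
Nothing here concerns the gauge theory: it is the combinatorial/homological half of Corollary 3.3; the analytic half
(Theorem 3.1, `GaugeStringDuality`) remains a named fact.
-/

noncomputable section

open Literature.Probability.LatticeModels Literature.MathematicalPhysics.QuantumLattice

namespace Literature.MathematicalPhysics.QuantumFieldTheory.Chatterjee2019LargeN

variable {d : ℕ}

/-! ### The 1-chain of a word: additivity, inversion, backtrack erasure, rotation -/

/-- `r(e⁻¹) = −r(e)`. [cite: Chatterjee2019LargeN, §3 (r(e) = e for e ∈ E⁺, −e⁻¹ for e ∈ E⁻)] -/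
theorem edgeChain_inv (a : DEdge d) : edgeChain (DEdge.inv a) = -edgeChain a := by
  obtain ⟨z, b⟩ := a
  cases b <;> simp [edgeChain, DEdge.inv]

/-- `r(∅) = 0`. [cite: Chatterjee2019LargeN, §3 (r(ρ) = Σ r(eᵢ))] -/
@[simp] theorem wordChain_nil : wordChain ([] : Word d) = 0 := rfl

/-- `r(e ρ) = r(e) + r(ρ)`. [cite: Chatterjee2019LargeN, §3 (r(ρ) = Σ r(eᵢ))] -/
@[simp] theorem wordChain_cons (a : DEdge d) (ρ : Word d) : wordChain (a :: ρ) = edgeChain a + wordChain ρ := by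
  simp [wordChain]

/-- `r(ρ ρ') = r(ρ) + r(ρ')`. [cite: Chatterjee2019LargeN, §3 (r(ρ) = Σ r(eᵢ))] -/
@[simp] theorem wordChain_append (ρ ρ' : Word d) : wordChain (ρ ++ ρ') = wordChain ρ + wordChain ρ' := by
  simp [wordChain, List.sum_append]

/-- `r(ρ⁻¹) = −r(ρ)`. [cite: Chatterjee2019LargeN, §3 (r of the inverse path)] -/
theorem wordChain_invRev (ρ : Word d) : wordChain (FreeGroup.invRev ρ) = -wordChain ρ := by
  induction ρ with
  | nil => simp [FreeGroup.invRev]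
  | cons a ρ ih =>
    rw [invRev_eq] at ih ⊢
    simp only [List.map_cons, List.reverse_cons, wordChain_append, wordChain_cons, wordChain_nil, add_zero,
      edgeChain_inv] at ih ⊢
    rw [ih]; abel

/-- Backtrack erasure does not change the 1-chain (`r(ρ) = r(ρ')` for a backtrack erasure `ρ → ρ'`).
[cite: Chatterjee2019LargeN, §14, proof of Lemma 14.1 («if ρ' is obtained from ρ by a backtrack erasure, then r(ρ) = r(ρ')»)] -/
theorem wordChain_eq_of_red {L₁ L₂ : Word d} (h : FreeGroup.Red L₁ L₂) : wordChain L₁ = wordChain L₂ := by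
  induction h with
  | refl => rfl
  | tail _ hstep ih =>
    rw [ih]
    cases hstep with
    | not =>
      simp only [wordChain_append, wordChain_cons]
      rw [show ∀ (x : ZdEdge d) (b : Bool), ((x, !b) : DEdge d) = DEdge.inv (x, b) from fun _ _ => rfl, edgeChain_inv]
      abel

/-- The nonbacktracking core has the same 1-chain: `r(l) = r([l])`. [cite: Chatterjee2019LargeN, §14 eq. (14.1) (r(l) = r([l]))] -/
theorem wordChain_core (ρ : Word d) : wordChain (core ρ) = wordChain ρ := by
  unfold core
  have h1 : wordChain (FreeGroup.reduce ρ) = wordChain ρ := (wordChain_eq_of_red FreeGroup.reduce.red).symm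
  have h2 := congrArg wordChain (FreeGroup.reduceCyclically.conj_conjugator_reduceCyclically (FreeGroup.reduce ρ))
  simp only [wordChain_append, wordChain_invRev] at h2
  rw [← h1, ← h2]; abel

/-- The 1-chain is a function of the cycle (rotation invariant). [cite: Chatterjee2019LargeN, §3 («r(ρ) is invariant under cyclic equivalence»)] -/
theorem wordChain_rotate (ρ : Word d) (k : ℕ) : wordChain (ρ.rotate k) = wordChain ρ :=
  List.Perm.sum_eq ((List.rotate_perm ρ k).map _)

namespace Word

/-- The rotation of `l` to location `x` reads `e_x · b · e_y · c` with `b = arcBetween`, `c = arcAfter` (for `x ≠ y`).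
[cite: Chatterjee2019LargeN, §2.2 (l = a e b e' c)] -/
theorem rotate_eq_letter_cons {l : Word d} {x y : Fin l.length} (hxy : x ≠ y) :
    l.rotate x = l.letter x :: (arcBetween l x y ++ l.letter y :: arcAfter l x y) := by
  have hn : 0 < l.length := Nat.lt_of_le_of_lt (Nat.zero_le _) x.isLt
  have hg := gap_pos l hxy
  have hgl := gap_lt l x y
  set R := l.rotate x with hR
  have hRl : R.length = l.length := by rw [hR, List.length_rotate]
  have h0 : R[0]'(by rw [hRl]; exact hn) = l.letter x := by
    rw [letter, List.get_eq_getElem]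
    simp only [hR, List.getElem_rotate, zero_add, Nat.mod_eq_of_lt x.isLt]
  have hgy : R[gap l x y]'(by rw [hRl]; exact hgl) = l.letter y := by
    rw [letter, List.get_eq_getElem]
    simp only [hR, List.getElem_rotate]
    congr 1
    haveI : NeZero l.length := ⟨by omega⟩
    rw [gap, ← Fin.val_add, sub_add_cancel]
  calc R = R[0]'(by rw [hRl]; exact hn) :: R.drop 1 := by rw [List.cons_getElem_drop_succ, List.drop_zero]
    _ = l.letter x :: ((R.drop 1).take (gap l x y - 1) ++ (R.drop 1).drop (gap l x y - 1)) := by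
        rw [h0, List.take_append_drop]
    _ = l.letter x :: (arcBetween l x y ++ l.letter y :: arcAfter l x y) := by
        rw [arcBetween, arcAfter, List.drop_drop, show 1 + (gap l x y - 1) = gap l x y by omega, ← hgy,
          List.cons_getElem_drop_succ]

/-- `r(×¹ l) + r(×² l) = r(l)` for a positive splitting (same edge at `x ≠ y`). [cite: Chatterjee2019LargeN, §14, proof of Lemma 14.1 («if s' is a splitting of s, then r(s) = r(s')»)] -/
theorem wordChain_posSplit {l : Word d} {x y : Fin l.length} (hxy : x ≠ y) (he : l.get y = l.get x) :
    wordChain (posSplit₁ l x y) + wordChain (posSplit₂ l x y) = wordChain l := by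
  rw [posSplit₁, posSplit₂, wordChain_core, wordChain_core, ← wordChain_rotate l x, rotate_eq_letter_cons hxy]
  simp only [wordChain_cons, wordChain_append, wordChain_nil, letter, he]
  abel

/-- `r(×¹ l) + r(×² l) = r(l)` for a negative splitting (`e` at `x`, `e⁻¹` at `y`). [cite: Chatterjee2019LargeN, §14, proof of Lemma 14.1 («if s' is a splitting of s, then r(s) = r(s')»)] -/
theorem wordChain_negSplit {l : Word d} {x y : Fin l.length} (he : l.get y = DEdge.inv (l.get x)) :
    wordChain (negSplit₁ l x y) + wordChain (negSplit₂ l x y) = wordChain l := by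
  have hxy : x ≠ y := by rintro rfl; exact DEdge.inv_ne_self _ he.symm
  rw [negSplit₁, negSplit₂, wordChain_core, wordChain_core, ← wordChain_rotate l x, rotate_eq_letter_cons hxy]
  simp only [wordChain_cons, wordChain_append, letter, he, edgeChain_inv]
  abel

/-- The four letters of the plaquette word of `p` carry exactly the four edges of `p`. [cite: Chatterjee2019LargeN, §2.1 (p = e₁e₂e₃⁻¹e₄⁻¹)] -/
theorem exists_letter_of_mem_plaquetteEdges {p : ZdPlaquette d} {e : ZdEdge d} (h : e ∈ plaquetteEdges p) :
    ∃ a ∈ plaquetteWord p, a.1 = e := by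
  simp only [plaquetteEdges, Finset.mem_insert, Finset.mem_singleton] at h
  simp only [plaquetteWord, List.mem_cons, List.not_mem_nil, or_false, exists_eq_or_imp, exists_eq_left]
  rcases h with h | h | h | h <;> simp [h]

/-- For `p ∈ 𝒫⁺(e)`, the plaquette word rotated to `plaquetteLoc p e` STARTS with the letter carrying `e`.
[cite: Chatterjee2019LargeN, §2.2 (l ⊕ₓ p: the unique location y in p containing e or e⁻¹)] -/
theorem rotate_plaquetteLoc_eq_cons {p : ZdPlaquette d} {e : DEdge d} (h : p ∈ plaquettesAt e) :
    ∃ a d', (plaquetteWord p).rotate (plaquetteLoc p e.1) = a :: d' ∧ a.1 = e.1 := by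
  have hmem : e.1 ∈ plaquetteEdges p := by
    rw [plaquettesAt, mem_plaquettesTouching_iff] at h
    obtain ⟨f, hf⟩ := h
    rw [Finset.mem_inter, Finset.mem_singleton] at hf
    exact hf.2 ▸ hf.1
  obtain ⟨a, ha, hae⟩ := exists_letter_of_mem_plaquetteEdges hmem
  have hlt : plaquetteLoc p e.1 < (plaquetteWord p).length :=
    List.findIdx_lt_length_of_exists ⟨a, ha, by simpa using hae⟩
  set R := (plaquetteWord p).rotate (plaquetteLoc p e.1) with hR
  have hRl : 0 < R.length := by rw [hR, List.length_rotate]; omega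
  refine ⟨R[0], R.drop 1, by rw [List.cons_getElem_drop_succ, List.drop_zero], ?_⟩
  have h0 : R[0] = (plaquetteWord p)[plaquetteLoc p e.1] := by
    simp only [hR, List.getElem_rotate, zero_add, Nat.mod_eq_of_lt hlt]
  rw [h0]
  unfold plaquetteLoc at hlt ⊢
  have := List.findIdx_getElem (w := hlt)
  simpa using this

/-- `r(l ⊕ₓ p) = r(l) ± r(p)`. [cite: Chatterjee2019LargeN, §14, proof of Lemma 14.1 (r(l ⊕ l') = r(l) ± r(l'))] -/
theorem wordChain_posDeform (l : Word d) (x : Fin l.length) {p : ZdPlaquette d} (hp : p ∈ plaquettesAt (l.get x)) :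
    ∃ σ : ℤ, (σ = 1 ∨ σ = -1) ∧ wordChain (posDeform l x p) = wordChain l + σ • plaquetteChain p := by
  obtain ⟨a, d', hrot, ha⟩ := rotate_plaquetteLoc_eq_cons hp
  have hL : l.rotate x = l.letter x :: (l.rotate x).drop 1 := by
    have hn : 0 < (l.rotate (x : ℕ)).length := by rw [List.length_rotate]; exact Nat.lt_of_le_of_lt (Nat.zero_le _) x.isLt
    have h := List.cons_getElem_drop_succ (l := l.rotate (x : ℕ)) (n := 0) (h := hn)
    rw [List.drop_zero] at h
    rw [← h]
    congr 1
    rw [letter, List.get_eq_getElem]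
    simp only [List.getElem_rotate, zero_add, Nat.mod_eq_of_lt x.isLt]
  have hlc : wordChain l = edgeChain (l.letter x) + wordChain ((l.rotate x).drop 1) := by
    rw [← wordChain_rotate l x]; conv_lhs => rw [hL]; rw [wordChain_cons]
  have hpc : plaquetteChain p = edgeChain a + wordChain d' := by
    rw [plaquetteChain, ← wordChain_rotate _ (plaquetteLoc p (l.letter x).1), letter, hrot, wordChain_cons]
  rw [posDeform, letter, hrot, hL, posMergeRot]
  by_cases h2 : a.2 = (l.letter x).2
  · -- `a = e`: `l ⊕ p = [e d' e b]`, `r = r(l) + r(p)`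
    have hae : a = l.letter x := Prod.ext ha h2
    refine ⟨1, Or.inl rfl, ?_⟩
    rw [if_pos h2, wordChain_core, hlc, hpc, hae]
    simp only [wordChain_cons, wordChain_append, one_smul]
    abel
  · -- `a = e⁻¹`: `l ⊕ p = [e d'⁻¹ e b]`, `r = r(l) − r(p)`
    have hae : a = DEdge.inv (l.letter x) := by
      refine Prod.ext ha ?_
      simp only [DEdge.inv]
      revert h2
      cases a.2 <;> cases (l.letter x).2 <;> decide
    refine ⟨-1, Or.inr rfl, ?_⟩
    rw [if_neg h2, wordChain_core, hlc, hpc, hae, edgeChain_inv]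
    simp only [wordChain_cons, wordChain_append, wordChain_invRev, neg_smul, one_smul]
    abel

/-- `r(l ⊖ₓ p) = r(l) ± r(p)`. [cite: Chatterjee2019LargeN, §14, proof of Lemma 14.1 (r(l ⊖ l') = r(l) ∓ r(l'))] -/
theorem wordChain_negDeform (l : Word d) (x : Fin l.length) {p : ZdPlaquette d} (hp : p ∈ plaquettesAt (l.get x)) :
    ∃ σ : ℤ, (σ = 1 ∨ σ = -1) ∧ wordChain (negDeform l x p) = wordChain l + σ • plaquetteChain p := by
  obtain ⟨a, d', hrot, ha⟩ := rotate_plaquetteLoc_eq_cons hp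
  have hL : l.rotate x = l.letter x :: (l.rotate x).drop 1 := by
    have hn : 0 < (l.rotate (x : ℕ)).length := by rw [List.length_rotate]; exact Nat.lt_of_le_of_lt (Nat.zero_le _) x.isLt
    have h := List.cons_getElem_drop_succ (l := l.rotate (x : ℕ)) (n := 0) (h := hn)
    rw [List.drop_zero] at h
    rw [← h]
    congr 1
    rw [letter, List.get_eq_getElem]
    simp only [List.getElem_rotate, zero_add, Nat.mod_eq_of_lt x.isLt]
  have hlc : wordChain l = edgeChain (l.letter x) + wordChain ((l.rotate x).drop 1) := by
    rw [← wordChain_rotate l x]; conv_lhs => rw [hL]; rw [wordChain_cons]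
  have hpc : plaquetteChain p = edgeChain a + wordChain d' := by
    rw [plaquetteChain, ← wordChain_rotate _ (plaquetteLoc p (l.letter x).1), letter, hrot, wordChain_cons]
  rw [negDeform, letter, hrot, hL, negMergeRot]
  by_cases h2 : a.2 = (l.letter x).2
  · have hae : a = l.letter x := Prod.ext ha h2
    refine ⟨-1, Or.inr rfl, ?_⟩
    rw [if_pos h2, wordChain_core, hlc, hpc, hae]
    simp only [wordChain_append, wordChain_invRev, neg_smul, one_smul]
    abel
  · have hae : a = DEdge.inv (l.letter x) := by
      refine Prod.ext ha ?_
      simp only [DEdge.inv]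
      revert h2
      cases a.2 <;> cases (l.letter x).2 <;> decide
    refine ⟨1, Or.inl rfl, ?_⟩
    rw [if_neg h2, wordChain_core, hlc, hpc, hae, edgeChain_inv]
    simp only [wordChain_append, one_smul]
    abel

end Word

/-! ### The 1-chain of a loop sequence and its change along a move -/

namespace LoopSeq

/-- `r(s) := r(l₁) + ⋯ + r(lₙ)`, `r(∅) = 0`. [cite: Chatterjee2019LargeN, §14, proof of Lemma 14.1 (definition of r(s))] -/
def seqChain (s : LoopSeq d) : ZdEdge d →₀ ℤ := (s.map wordChain).sum

/-- `r(∅) = 0`. [cite: Chatterjee2019LargeN, §14 (r(∅) = 0)] -/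
@[simp] theorem seqChain_nil : seqChain ([] : LoopSeq d) = 0 := rfl

/-- `r((l, s)) = r(l) + r(s)`. [cite: Chatterjee2019LargeN, §14 (r(s) = Σ r(lᵢ))] -/
@[simp] theorem seqChain_cons (l : Word d) (s : LoopSeq d) : seqChain (l :: s) = wordChain l + seqChain s := by
  simp [seqChain]

/-- Additivity over concatenation. [cite: Chatterjee2019LargeN, §14 (r(s) = Σ r(lᵢ))] -/
@[simp] theorem seqChain_append (s t : LoopSeq d) : seqChain (s ++ t) = seqChain s + seqChain t := by
  simp [seqChain, List.sum_append]

/-- Deleting null loops does not change `r(s)`. [cite: Chatterjee2019LargeN, §14 (r(∅) = 0)] -/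
theorem seqChain_prune (s : LoopSeq d) : seqChain (prune s) = seqChain s := by
  induction s with
  | nil => rfl
  | cons l s ih =>
    by_cases h : l = []
    · subst h
      have : prune (([] : Word d) :: s) = prune s := by simp [prune]
      rw [this, ih, seqChain_cons, wordChain_nil, zero_add]
    · have : prune (l :: s) = l :: prune s := by simp [prune, h]
      rw [this, seqChain_cons, seqChain_cons, ih]

/-- `r` bookkeeping of a replacement: `r(s') + r(lᵢ) = r(s) + Σ r(w)`. [cite: Chatterjee2019LargeN, §14, proof of Lemma 14.1] -/
theorem seqChain_replaceAt (s : LoopSeq d) (i : Fin s.length) (ws : List (Word d)) :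
    seqChain (s.replaceAt i ws) + wordChain (s.get i) = seqChain s + seqChain ws := by
  have hsplit : s = s.take i ++ s.get i :: s.drop (i + 1) := by
    rw [List.get_eq_getElem, List.cons_getElem_drop_succ, List.take_append_drop]
  rw [replaceAt, seqChain_prune, seqChain_append, seqChain_append]
  conv_rhs => rw [hsplit, seqChain_append, seqChain_cons]
  abel

/-- A positive splitting does not change `r(s)`. [cite: Chatterjee2019LargeN, §14, proof of Lemma 14.1 («if s' is a splitting of s, then r(s) = r(s')»)] -/
theorem seqChain_posSplitAt (s : LoopSeq d) (o : SameIdx s) : seqChain (s.posSplitAt o) = seqChain s := by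
  obtain ⟨i, ⟨⟨x, y⟩, hxy, he⟩⟩ := o
  have h := seqChain_replaceAt s i [Word.posSplit₁ (s.get i) x y, Word.posSplit₂ (s.get i) x y]
  rw [seqChain_cons, seqChain_cons, seqChain_nil, add_zero, Word.wordChain_posSplit hxy he] at h
  exact add_right_cancel h

/-- A negative splitting does not change `r(s)`. [cite: Chatterjee2019LargeN, §14, proof of Lemma 14.1 («if s' is a splitting of s, then r(s) = r(s')»)] -/
theorem seqChain_negSplitAt (s : LoopSeq d) (o : InvIdx s) : seqChain (s.negSplitAt o) = seqChain s := by
  obtain ⟨i, ⟨⟨x, y⟩, he⟩⟩ := o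
  have h := seqChain_replaceAt s i [Word.negSplit₁ (s.get i) x y, Word.negSplit₂ (s.get i) x y]
  rw [seqChain_cons, seqChain_cons, seqChain_nil, add_zero, Word.wordChain_negSplit he] at h
  exact add_right_cancel h

/-- A positive deformation by `p` changes `r(s)` by `± δp`. [cite: Chatterjee2019LargeN, §14, proof of Lemma 14.1] -/
theorem seqChain_posDeformAt (s : LoopSeq d) (o : DeformIdx s) :
    ∃ σ : ℤ, (σ = 1 ∨ σ = -1) ∧ seqChain (s.posDeformAt o) = seqChain s + σ • plaquetteChain (o.2.2 : ZdPlaquette d) := by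
  obtain ⟨i, x, ⟨p, hp⟩⟩ := o
  obtain ⟨σ, hσ, hc⟩ := Word.wordChain_posDeform (s.get i) x hp
  have h := seqChain_replaceAt s i [Word.posDeform (s.get i) x p]
  rw [seqChain_cons, seqChain_nil, add_zero, hc] at h
  refine ⟨σ, hσ, ?_⟩
  have := congrArg (fun z => z - wordChain (s.get i)) h
  simp only [add_sub_cancel_right] at this
  rw [posDeformAt, this]; abel

/-- A negative deformation by `p` changes `r(s)` by `± δp`. [cite: Chatterjee2019LargeN, §14, proof of Lemma 14.1] -/
theorem seqChain_negDeformAt (s : LoopSeq d) (o : DeformIdx s) :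
    ∃ σ : ℤ, (σ = 1 ∨ σ = -1) ∧ seqChain (s.negDeformAt o) = seqChain s + σ • plaquetteChain (o.2.2 : ZdPlaquette d) := by
  obtain ⟨i, x, ⟨p, hp⟩⟩ := o
  obtain ⟨σ, hσ, hc⟩ := Word.wordChain_negDeform (s.get i) x hp
  have h := seqChain_replaceAt s i [Word.negDeform (s.get i) x p]
  rw [seqChain_cons, seqChain_nil, add_zero, hc] at h
  refine ⟨σ, hσ, ?_⟩
  have := congrArg (fun z => z - wordChain (s.get i)) h
  simp only [add_sub_cancel_right] at this
  rw [negDeformAt, this]; abel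

end LoopSeq

/-! ### Lattice surfaces: subadditivity of the area, the surface swept by a trajectory -/

/-- `area(x + y) ≤ area(x) + area(y)`. [cite: Chatterjee2019LargeN, §3 (area(x) = Σ |n_p|)] -/
theorem surfaceArea_add_le (x y : ZdPlaquette d →₀ ℤ) : surfaceArea (x + y) ≤ surfaceArea x + surfaceArea y := by
  classical
  unfold surfaceArea
  rw [Finsupp.sum_of_support_subset (x + y) Finsupp.support_add _ (fun _ _ => rfl),
    Finsupp.sum_of_support_subset x (Finset.subset_union_left (s₂ := y.support)) _ (fun _ _ => rfl),
    Finsupp.sum_of_support_subset y (Finset.subset_union_right (s₁ := x.support)) _ (fun _ _ => rfl),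
    ← Finset.sum_add_distrib]
  exact Finset.sum_le_sum fun p _ => Int.natAbs_add_le _ _

/-- `area(σ p) = 1` for `σ = ±1`. [cite: Chatterjee2019LargeN, §3 (area(x) = Σ |n_p|)] -/
theorem surfaceArea_single_unit (p : ZdPlaquette d) {σ : ℤ} (hσ : σ = 1 ∨ σ = -1) :
    surfaceArea (Finsupp.single p σ) = 1 := by
  unfold surfaceArea
  rw [Finsupp.sum_single_index (by simp)]
  rcases hσ with rfl | rfl <;> simp

/-- `δ(σ p) = σ δp`. [cite: Chatterjee2019LargeN, §3 (δ extended linearly)] -/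
theorem boundary_single (p : ZdPlaquette d) (σ : ℤ) : boundary (Finsupp.single p σ) = σ • plaquetteChain p := by
  rw [boundary, Finsupp.linearCombination_single]

/-- **Every move is bounded by a surface of area `≤` its number of deformations**: `r(s) = r(s') + δy` with
`area(y) ≤ 1` for a deformation, `y = 0` for a splitting. [cite: Chatterjee2019LargeN, §14, proof of Lemma 14.1] -/
theorem Move.exists_surface {s : LoopSeq d} (m : Move s) :
    ∃ y : ZdPlaquette d →₀ ℤ, surfaceArea y ≤ (if m.isDeform then 1 else 0) ∧
      LoopSeq.seqChain s = LoopSeq.seqChain m.result + boundary y := by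
  cases m with
  | posDeform o =>
    obtain ⟨σ, hσ, hc⟩ := LoopSeq.seqChain_posDeformAt s o
    refine ⟨Finsupp.single (o.2.2 : ZdPlaquette d) (-σ), ?_, ?_⟩
    · rw [surfaceArea_single_unit _ (by rcases hσ with rfl | rfl <;> simp)]; simp [Move.isDeform]
    · rw [Move.result, hc, boundary_single, neg_smul]; abel
  | negDeform o =>
    obtain ⟨σ, hσ, hc⟩ := LoopSeq.seqChain_negDeformAt s o
    refine ⟨Finsupp.single (o.2.2 : ZdPlaquette d) (-σ), ?_, ?_⟩
    · rw [surfaceArea_single_unit _ (by rcases hσ with rfl | rfl <;> simp)]; simp [Move.isDeform]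
    · rw [Move.result, hc, boundary_single, neg_smul]; abel
  | posSplit o =>
    refine ⟨0, by simp [surfaceArea], ?_⟩
    rw [Move.result, LoopSeq.seqChain_posSplitAt, map_zero, add_zero]
  | negSplit o =>
    refine ⟨0, by simp [surfaceArea], ?_⟩
    rw [Move.result, LoopSeq.seqChain_negSplitAt, map_zero, add_zero]

/-- **Along a vanishing trajectory** with `k` deformations by `p₁, …, p_k`: `r(s₀) = Σ σⱼ δpⱼ = δ(Σ σⱼ pⱼ)`, a lattice
surface of area `≤ k`. [cite: Chatterjee2019LargeN, §14, proof of Lemma 14.1] -/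
theorem Trajectory.exists_surface : ∀ {s : LoopSeq d} (X : Trajectory s),
    ∃ x : ZdPlaquette d →₀ ℤ, boundary x = LoopSeq.seqChain s ∧ surfaceArea x ≤ X.numDeform
  | _, Trajectory.nil => by refine ⟨0, ?_, ?_⟩ <;> simp [surfaceArea]
  | _, Trajectory.cons m X => by
    obtain ⟨x', hx', ha'⟩ := Trajectory.exists_surface X
    obtain ⟨y, hy, hc⟩ := Move.exists_surface m
    refine ⟨x' + y, ?_, ?_⟩
    · rw [map_add, hx', ← hc]
    · refine (surfaceArea_add_le _ _).trans ?_
      rw [Trajectory.numDeform]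
      split_ifs at hy ⊢ <;> omega

/-- **Chatterjee 2019, Lemma 14.1 — PROVED.** A vanishing trajectory starting from the loop `l` has at least `area(l)`
deformations. (The source states it for non-null `l`; for the null loop both sides are `0`.) [cite: Chatterjee2019LargeN, Lemma 14.1] -/
theorem area_le_numDeform (l : Word d) (X : Trajectory [l]) : area l ≤ X.numDeform := by
  obtain ⟨x, hx, ha⟩ := Trajectory.exists_surface X
  rw [LoopSeq.seqChain_cons, LoopSeq.seqChain_nil, add_zero] at hx
  exact (Nat.sInf_le (s := {A : ℕ | ∃ x : ZdPlaquette d →₀ ℤ, IsBoundaryOf l x ∧ surfaceArea x = A})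
    ⟨x, hx, rfl⟩).trans ha

/-- Hence `𝒳ₖ((l))` is empty for `k < area(l)` … [cite: Chatterjee2019LargeN, §14 (proof of Cor. 3.3: «a_k(l) = 0 when k < area(l)»)] -/
theorem isEmpty_trajectoryWith_of_lt_area (l : Word d) {k : ℕ} (hk : k < area l) : IsEmpty (TrajectoryWith [l] k) :=
  ⟨fun X => absurd (area_le_numDeform l X.1) (by rw [X.2]; omega)⟩

/-- … and `a_k(l) = 0` for `k < area(l)`. [cite: Chatterjee2019LargeN, §14 (proof of Cor. 3.3: «a_k(l) = 0 when k < area(l)»)] -/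
theorem coeffA_singleton_eq_zero_of_lt_area (l : Word d) {k : ℕ} (hk : k < area l) : coeffA [l] k = 0 := by
  haveI := isEmpty_trajectoryWith_of_lt_area l hk
  exact tsum_empty

section CorollaryLoopwise

open Filter Topology

/-! ### The plaquette has area one; `a₀((p)) = 0` -/

/-- `δp ≠ 0`: the coefficient of the first edge `e₁ = (x, j)` of `p` (plane `i < j`) in `δp = e₁ + e₂ - e₃ - e₄` is `1`
(the four edges of a plaquette are distinct). [cite: Chatterjee2019LargeN, §3 (δp = e₁ + e₂ − e₃ − e₄)] -/
theorem plaquetteChain_apply_fst (p : ZdPlaquette d) :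
    plaquetteChain p (p.1, p.2.1.2) = 1 := by
  obtain ⟨x, ⟨⟨i, j⟩, hij⟩⟩ := p
  have hne : i ≠ j := ne_of_lt hij
  have h2 : x + Pi.single i (1 : ℤ) ≠ x := by
    intro h
    have := congrFun h i
    simp at this
  simp only [plaquetteChain, wordChain, plaquetteWord, List.map_cons, List.map_nil, List.sum_cons, List.sum_nil,
    edgeChain, Finsupp.add_apply, Finsupp.single_apply, Prod.mk.injEq, add_zero]
  simp [hne, h2]

/-- `δp ≠ 0`. [cite: Chatterjee2019LargeN, §3 (δp)] -/
theorem plaquetteChain_ne_zero (p : ZdPlaquette d) : plaquetteChain p ≠ 0 := by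
  intro h
  have := plaquetteChain_apply_fst p
  rw [h, Finsupp.zero_apply] at this
  exact zero_ne_one this

/-- **The plaquette loop has area one**: `area(p) = 1` (`x = p` bounds `p`; no surface of area `0` does,
since `δ0 = 0 ≠ δp = r(p)`). [cite: Chatterjee2019LargeN, §3 (area(l); a plaquette is the boundary of itself)] -/
theorem area_plaquetteWord (p : ZdPlaquette d) : area (plaquetteWord p) = 1 := by
  have hmem : (1 : ℕ) ∈ {A : ℕ | ∃ x : ZdPlaquette d →₀ ℤ, IsBoundaryOf (plaquetteWord p) x ∧ surfaceArea x = A} :=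
    ⟨Finsupp.single p 1, by rw [IsBoundaryOf, boundary_single, one_smul]; rfl,
      surfaceArea_single_unit p (Or.inl rfl)⟩
  refine le_antisymm (Nat.sInf_le hmem) ?_
  have hne : {A : ℕ | ∃ x : ZdPlaquette d →₀ ℤ, IsBoundaryOf (plaquetteWord p) x ∧ surfaceArea x = A}.Nonempty :=
    ⟨1, hmem⟩
  obtain ⟨x, hx, hA⟩ := Nat.sInf_mem hne
  rw [area, ← hA]
  refine Nat.one_le_iff_ne_zero.mpr fun h0 => ?_
  have hx0 : x = 0 := by
    ext q
    have := Finset.sum_eq_zero_iff.mp h0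
    by_cases hq : q ∈ x.support
    · have h := this q hq
      simpa using h
    · simpa [Finsupp.mem_support_iff] using hq
  rw [IsBoundaryOf, hx0, map_zero] at hx
  exact plaquetteChain_ne_zero p (by rw [plaquetteChain]; exact hx.symm)

/-- **`a₀((p)) = 0`** for a plaquette `p` — the first of the printed coefficients of §4 («`a₀ = 0`»), here in
every dimension, from Lemma 14.1 (`area(p) = 1 > 0`). [cite: Chatterjee2019LargeN, §4 (last paragraph: a₀ = 0), §14] -/
theorem coeffA_plaquette_zero (p : ZdPlaquette d) : coeffA [plaquetteWord p] 0 = 0 :=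
  coeffA_singleton_eq_zero_of_lt_area _ (by rw [area_plaquetteWord]; exact Nat.one_pos)

/-- The `k = 0` instance of the printed table `PlaquetteCoefficientsZ3` holds (`a₀ = 0`).
[cite: Chatterjee2019LargeN, §4 (last paragraph)] -/
theorem plaquetteCoefficientsZ3_zero (p : ZdPlaquette 3) :
    coeffA [plaquetteWord p] 0 = (plaquetteCoeffZ3 0 : ℝ) := by
  rw [coeffA_plaquette_zero]; simp [plaquetteCoeffZ3]

/-! ### Corollary 3.3 as proved in §14: the area law upper bound with a loop-dependent prefactor

The printed proof of Corollary 3.3 (§14, after Lemma 14.1) runs: by Corollary 3.5,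
`lim ⟨W_l⟩/N = Σ_k a_k(l) β^k` with `|a_k(l)| ≤ C(l)^k`, and `a_k(l) = 0` for `k < area(l)`, hence
`lim |⟨W_l⟩|/N ≤ Σ_{k ≥ area(l)} C(l)^k |β|^k` — «This completes the proof of Corollary 3.3 when `|β|` is small
enough.»  The constant obtained this way depends on the loop `l`; the uniformity `C = C(d)` asserted in the
statement of Corollary 3.3 (the tree's named fact `AreaLawUpperBound`) is not supplied by this argument.  The
theorem below is exactly what the printed argument yields, from Corollary 3.5 (`RealAnalyticityStrongCoupling`)
and Lemma 14.1: with `M(l) = Σ_k |a_k(l)| β₀^k < ∞`, for every `|β| ≤ β₀`,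
`lim_N |⟨W_l⟩_{Λ_N,N,β}|/N ≤ M(l) (|β|/β₀)^{area(l)}`. -/

/-- **Corollary 3.3, loopwise form (PROVED from Corollary 3.5 and Lemma 14.1).** For `d ≥ 2` there is `β₀ > 0`
(that of Corollary 3.5) such that for every exhaustion `Λ_N ↑ ℤ^d` and every non-null loop `l` there is
`M = M(l) ≥ 0` with: for all `|β| ≤ β₀`, `lim_N |⟨W_l⟩_{Λ_N,N,β}| / N` exists and is `≤ M (|β|/β₀)^{area(l)}`.
(The printed statement of Corollary 3.3 has a constant depending only on `d`; see the section docstring.)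
[cite: Chatterjee2019LargeN, Corollary 3.3 and its proof in §14 (p. 35: «there is a constant C(l) such that |a_k(l)| ≤ C(l)^k»)] -/
theorem areaLawUpperBound_loopwise (h : RealAnalyticityStrongCoupling d) (hd : 2 ≤ d) :
    ∃ β₀ : ℝ, 0 < β₀ ∧
      ∀ Λ : ℕ → Finset (Literature.Probability.LatticeModels.Site d), IsExhaustion Λ →
        ∀ l : Word d, IsLoop l → l ≠ [] →
          ∃ M : ℝ, 0 ≤ M ∧ ∀ β : ℝ, |β| ≤ β₀ →
            ∃ L : ℝ,
              Tendsto (fun N : ℕ => |soExpect N β (Λ N) (wilsonLoopVar N l)| / N) atTop (𝓝 L) ∧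
                L ≤ M * (|β| / β₀) ^ area l := by
  obtain ⟨β₀, hβ₀, H⟩ := h hd
  refine ⟨β₀, hβ₀, fun Λ hΛ l hl hne => ?_⟩
  have hs : IsLoopSeq [l] := fun l' hl' => by
    rw [List.mem_singleton] at hl'; subst hl'; exact ⟨hl, hne⟩
  -- `M(l) = Σ_k |a_k(l)| β₀^k`, finite by Corollary 3.5 at `β = β₀`
  have hsum₀ : Summable fun k : ℕ => |coeffA [l] k| * β₀ ^ k := by
    have := (H Λ hΛ β₀ (by rw [abs_of_pos hβ₀]) [l] hs (List.cons_ne_nil _ _)).1.abs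
    simpa [abs_mul, abs_of_pos hβ₀] using this
  refine ⟨∑' k : ℕ, |coeffA [l] k| * β₀ ^ k, tsum_nonneg fun k => by positivity, fun β hβ => ?_⟩
  obtain ⟨hsum, hlim⟩ := H Λ hΛ β hβ [l] hs (List.cons_ne_nil _ _)
  refine ⟨|∑' k : ℕ, coeffA [l] k * β ^ k|, ?_, ?_⟩
  · -- `|⟨W_l⟩|/N = |φ_N((l))| → |Σ a_k β^k|`
    have := hlim.abs
    refine this.congr fun N => ?_
    rw [phi_singleton, abs_div, Nat.abs_cast]
  · -- `|Σ_k a_k β^k| ≤ Σ_{k ≥ area} |a_k| β₀^k (|β|/β₀)^k ≤ M (|β|/β₀)^{area}`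
    have hq0 : 0 ≤ |β| / β₀ := by positivity
    have hq1 : |β| / β₀ ≤ 1 := by rwa [div_le_one hβ₀]
    have hterm : ∀ k : ℕ, ‖coeffA [l] k * β ^ k‖ ≤ |coeffA [l] k| * β₀ ^ k * (|β| / β₀) ^ area l := by
      intro k
      rw [Real.norm_eq_abs, abs_mul, abs_pow]
      by_cases hk : k < area l
      · rw [coeffA_singleton_eq_zero_of_lt_area l hk]; simp
      · rw [not_lt] at hk
        have hβk : |β| ^ k = β₀ ^ k * (|β| / β₀) ^ k := by
          rw [← mul_pow, mul_div_cancel₀ _ hβ₀.ne']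
        rw [hβk, ← mul_assoc]
        exact mul_le_mul_of_nonneg_left (pow_le_pow_of_le_one hq0 hq1 hk) (by positivity)
    have hsum' : Summable fun k : ℕ => |coeffA [l] k| * β₀ ^ k * (|β| / β₀) ^ area l :=
      hsum₀.mul_right _
    calc |∑' k : ℕ, coeffA [l] k * β ^ k|
        = ‖∑' k : ℕ, coeffA [l] k * β ^ k‖ := (Real.norm_eq_abs _).symm
      _ ≤ ∑' k : ℕ, |coeffA [l] k| * β₀ ^ k * (|β| / β₀) ^ area l :=
          tsum_of_norm_bounded hsum'.hasSum hterm
      _ = (∑' k : ℕ, |coeffA [l] k| * β₀ ^ k) * (|β| / β₀) ^ area l := tsum_mul_right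

end CorollaryLoopwise

end Literature.MathematicalPhysics.QuantumFieldTheory.Chatterjee2019LargeN

end
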